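import Summits.Ventures.PercRepro.S2FiveWindow
import Summits.Ventures.PercRepro.RankLevelSetCoreFiveTwentyNine

/-!
# PercRepro — SUB-CLAIM S2, the reduction from `P ≥ 29` (p7, gen 0)

`S2FiveWindow.rls_five_of_four_of_cells` reduces level `5` at `p ≥ P + 1` to level `4` at `p ≥ P` and the 22 corank
cells `6 ≤ d ≤ 27` of the `e`-free core at `p ≥ P`, for `P ≥ 50` — the `50` being the threshold of night-1's
corank-`≥ 28` core theorem. With `c025_core_five_twentyone_twentynine` (RankLevelSetCoreFiveTwentyNine, `p ≥ 29`)
the same reduction holds for every `P ≥ 29`: **`rls_five_of_four_of_cells'`**, **`rls_five_window_of_cells'`**.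
The open part of S2 is then exactly: level `5` on `7 ≤ p ≤ P` and the cells `(p, d)`, `p ≥ P`, `6 ≤ d ≤ 27`,
for any `P ≥ 29` (plus level `4` on `p ≥ P`, sub-claims S1 / S6). Axioms: standard.
-/

open scoped Matroid

namespace PercRepro

namespace S2

open ThmN

variable {α : Type}

/-- **The window's core clause is the 22 corank cells `6 ≤ d ≤ 27`, for every `P ≥ 29`**: coranks `≥ 28` are
`c025_core_five_twentyone_twentynine`. -/
theorem rls_five_of_four_of_cells' (P : ℕ) (hP : 29 ≤ P)
    (h4 : ∀ (M : Matroid α) [M.Finite] (p : ℕ), P ≤ p → RLS M p 4)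
    (hcells : ∀ (M : Matroid α) [M.Finite] (p d : ℕ), P ≤ p → 6 ≤ d → d ≤ 27 → M.eRank = (p : ℕ∞) →
      M.E.ncard = p + d →
      (∀ e ∈ M.E, ∃ A ⊆ M.E \ {e}, e ∉ M.closure A ∧ e ∉ M.closure ((M.E \ {e}) \ A)) → RLS M p 5) :
    ∀ (M : Matroid α) [M.Finite] (p : ℕ), P + 1 ≤ p → RLS M p 5 := by
  refine rls_five_of_four_of_core P (by omega) h4 ?_
  intro M _ p hP' hR hbig hfree
  rcases Nat.lt_or_ge M.E.ncard (p + 28) with h | h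
  · exact hcells M p (M.E.ncard - p) hP' (by omega) (by omega) hR (by omega) hfree
  · exact c025_core_five_twentyone_twentynine M p (by omega) hR (by omega) hfree

/-- **S2 from its three named inputs, for every `P ≥ 29`**: the small cells `7 ≤ p ≤ P` at level `5`, level `4` on
`p ≥ P` (sub-claims S1 / S6), and the 22 corank cells of the `e`-free core at `p ≥ P`. -/
theorem rls_five_window_of_cells' (P : ℕ) (hP : 29 ≤ P)
    (hsmall : ∀ {α : Type} (M : Matroid α) [M.Finite] (p : ℕ), 7 ≤ p → p ≤ P → RLS M p 5)
    (h4 : ∀ {α : Type} (M : Matroid α) [M.Finite] (p : ℕ), P ≤ p → RLS M p 4)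
    (hcells : ∀ {α : Type} (M : Matroid α) [M.Finite] (p d : ℕ), P ≤ p → 6 ≤ d → d ≤ 27 →
      M.eRank = (p : ℕ∞) → M.E.ncard = p + d →
      (∀ e ∈ M.E, ∃ A ⊆ M.E \ {e}, e ∉ M.closure A ∧ e ∉ M.closure ((M.E \ {e}) \ A)) → RLS M p 5) :
    S2Window := by
  intro α M _ p hp _
  rcases Nat.lt_or_ge P p with hlt | hle
  · exact rls_five_of_four_of_cells' P hP (fun M _ p hp => h4 M p hp)
      (fun M _ p d hp h6 h27 hR hn hfree => hcells M p d hp h6 h27 hR hn hfree) M p (by omega)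
  · exact hsmall M p hp hle

end S2

end PercRepro
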